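import Summits.BirchSwinnertonDyer.BirchSwinnertonDyer.Theorems.GenusKolyvaginAtTwoPubInputsAtTwoDefs
import Summits.BirchSwinnertonDyer.BirchSwinnertonDyer.Theorems.GenusKolyvaginAtTwoPowDvdShaCardAtTwoRTMilneDefect
import HarnessLib

/-!
# Route `GenusKolyvaginAtTwo`, LINE 18 (`plus_descent` v4.2 on L_T `PowDvdShaCardAtTwoRT`, stmt-BirchSwinnertonDyer-23242):
# the registered stub 3b″ `stub_milneDefect` PROVED BY NAME AND SIGNATURE

Seat `bsd-line-gk2-p3` g17 (cell `bsd-f1-sign2`), `--supports stmt-BirchSwinnertonDyer-23242` (stub `stub_milneDefect` of the line of record,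
skeleton sha 5e1bc4fb6f2a…, registered 2026-08-28T23:41Z).  THEOREM ONLY; no definition, no named fact, no `sorry`; BSD is not proved.

The v4.2 stub is v3's Milne-defect identity behind the antecedent `PubInputsAtTwo` (tree def, `…GenusKolyvaginAtTwoPubInputsAtTwoDefs`,
body = the skeleton's): on the LINE 18 frame (`Δ < 0`, odd Tamagawa, Heegner field `K` with odd `d_K`, `y_1` of infinite order, …),
for every globally minimal `Wd ≅ E^{(d_K)}`, the three `#Ш[2^∞]` are positive and the Ш-free BSD ratio `ρ = B(W)B(Wd)/B(W_K)` is a non-zero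
rational `q` with `ord₂ #Ш(E_K)[2^∞] = ord₂ #Ш(E)[2^∞] + ord₂ #Ш(E^{d_K})[2^∞] + ord₂ q`.  It is g16's `stub_milneDefect_of_facts`
(p672162: Kolyvagin finiteness + Milne 1972 Thm. 1 for any model, i.e. the named facts `kolyvagin` and
`Milne1972.bsdQuotient_baseChange_quadratic_anyModel = MilneAnyModel`) fed with the second and fifth conjuncts of `PubInputsAtTwo`
— the pen's own closer `fun h => stub_milneDefect_of_facts h.2.1 h.2.2.2.2` (`line18/closer_3b_check.lean`, rc 0).

References: [Milne1972ArithmeticAV] §1 Thm. 1; [DokchitserDokchitserAnnals2010] Thm. 2.3; [Kolyvagin1989] Thm. A; [Kramer1981] Thm. 1.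
-/

set_option autoImplicit false
-- the Theorems namespace of this sub repeats the summit name by design (D-0017 nested layout)
set_option linter.dupNamespace false

noncomputable section

open scoped Classical

namespace Summit.BirchSwinnertonDyer.BirchSwinnertonDyer.Theorems.GenusExact.PlusDescent

open WeierstrassCurve NumberField IsDedekindDomain Field
open Literature.NumberTheory.GaloisRepresentations Literature.NumberTheory.EllipticCurves
open Literature.NumberTheory
open Summit.BirchSwinnertonDyer.BirchSwinnertonDyer.Theses.GenusKolyvaginAtTwo

/-- **LINE 18 stub 3b″ `stub_milneDefect` (v4.2), by name and signature — the Milne defect identity at `2` on `Δ < 0`.**  Behind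
`PubInputsAtTwo`: on the frame, for any globally minimal `Wd ≅ E^{(d_K)}`, `#Ш(E/ℚ)[2^∞]`, `#Ш(E^{d_K}/ℚ)[2^∞]`, `#Ш(E_K/K)[2^∞]` are
positive and the Ш-free ratio `ρ = B(W)·B(Wd)/B(W_K)` is a non-zero rational `q` with `ord₂ G = ord₂ g + ord₂ g' + ord₂ q`
(Kolyvagin's finiteness + Milne 1972 Thm. 1 / Dokchitser–Dokchitser Thm. 2.3 for any models; g16's `stub_milneDefect_of_facts` with the
Kolyvagin and Milne conjuncts of `PubInputsAtTwo`). [cite: Milne1972ArithmeticAV, §1 Thm 1] [cite: DokchitserDokchitserAnnals2010, Thm 2.3]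
[cite: Kolyvagin1989Izv, Thm. A] [cite: Kramer1981, Thm 1] -/
theorem stub_milneDefect :
    PubInputsAtTwo → ∀ (W : WeierstrassCurve ℚ) [W.IsElliptic] [W.IsGloballyMinimal] [NeZero (W.conductorNorm ℤ)], ¬ W.HasCM → Odd W.tamagawaProduct → W.Δ < 0 → ∀ (K : Type) [Field K] [NumberField K], Literature.NumberTheory.EllipticCurves.IsImaginaryQuadratic K → Odd (NumberField.discr K) → NumberField.discr K ≠ -3 → Literature.NumberTheory.EllipticCurves.SatisfiesHeegnerHypothesis (W.conductorNorm ℤ) K → ¬ IsSquare ((NumberField.discr K : ℚ) * -|W.Δ|) → ¬ IsSquare ((NumberField.discr K : ℚ) * (-(2 * |W.Δ|))) → (∀ n : ℕ, 0 < n → W.HasSurjectiveModNGaloisRep ((2 : ℤ) ^ n)) → ∀ (Dt : Literature.NumberTheory.EllipticCurves.ModularForms.ModularParametrizationData W (W.conductorNorm ℤ)) (β : ℤ) (ι : K →+* ℂ) (d₁ : Literature.NumberTheory.EllipticCurves.KolyvaginHeegnerData Dt β ι 1), ¬ IsOfFinAddOrder d₁.derivedPoint → ∀ (M₀ : ℕ),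 (∃ Q : (W.baseChange (Literature.NumberTheory.EllipticCurves.ringClassField K ι 1)).toAffine.Point, ((2 ^ M₀ : ℕ) : ℤ) • Q = d₁.derivedPoint) → (¬ ∃ Q : (W.baseChange (Literature.NumberTheory.EllipticCurves.ringClassField K ι 1)).toAffine.Point, ((2 ^ (M₀ + 1) : ℕ) : ℤ) • Q = d₁.derivedPoint) → ∀ (n : ℕ) (d : Literature.NumberTheory.EllipticCurves.KolyvaginHeegnerData Dt β ι n), Squarefree n → (∀ ℓ ∈ n.primeFactors, Literature.NumberTheory.EllipticCurves.Zhang2014.IsKolyvaginPrime (W.conductorNorm ℤ) W K 2 ℓ) → (¬ ∃ Q : (W.baseChange (Literature.NumberTheory.EllipticCurves.ringClassField K ι n)).toAffine.Point, (2 : ℤ) • Q = d.derivedPoint) → ∀ (Wd : WeierstrassCurve ℚ) [Wd.IsElliptic] [Wd.IsGloballyMinimal], (∃ C : WeierstrassCurve.VariableChange ℚ, C • W.quadraticTwist (NumberField.discr K : ℚ) = Wd) → 0 < Nat.card (AddCommGroup.primaryComponent W.sha 2) ∧ 0 < Nat.card (AddCommGroup.primaryComponent Wd.sha 2) ∧ 0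 < Nat.card (AddCommGroup.primaryComponent (W.baseChange K).sha 2) ∧ ∃ q : ℚ, q ≠ 0 ∧ (q : ℝ) = (W.regulator * W.bsdPeriod * ((W.modifiedTamagawaProduct : ℚ) : ℝ) / ((W.torsionOrder : ℕ) : ℝ) ^ 2) * (Wd.regulator * Wd.bsdPeriod * ((Wd.modifiedTamagawaProduct : ℚ) : ℝ) / ((Wd.torsionOrder : ℕ) : ℝ) ^ 2) / ((W.baseChange K).regulator * (W.baseChange K).bsdPeriod * (((W.baseChange K).modifiedTamagawaProduct : ℚ) : ℝ) / (((W.baseChange K).torsionOrder : ℕ) : ℝ) ^ 2) ∧ (padicValNat 2 (Nat.card (AddCommGroup.primaryComponent (W.baseChange K).sha 2)) : ℤ) = (padicValNat 2 (Nat.card (AddCommGroup.primaryComponent W.sha 2)) : ℤ) + (padicValNat 2 (Nat.card (AddCommGroup.primaryComponent Wd.sha 2)) : ℤ) + padicValRat 2 q :=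
  fun h ↦ stub_milneDefect_of_facts h.2.1 h.2.2.2.2

end Summit.BirchSwinnertonDyer.BirchSwinnertonDyer.Theorems.GenusExact.PlusDescent

end
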